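import Summits.Ventures.GridStability.Lyapunov.NE39LossySplitLinesLPDualKernel
import HarnessLib

/-!
# «NE39-LOSSY-SPLITU-CEILING» — kernel file 2 of 2: the dual functionals over `ℚ` and the acceptance tests (D2), (D3′),
# (D4), the null channels, the window-point tests — all 200 channels, decided in the kernel

Cell `gridfusion` (39-bus rung, OBSTRUCTION side); seat gridfusion-lit-6 (g10).  `u_k = (CZ₁₁Cᵀ)_kk`, `v_k = (Z₂₁Cᵀ)_kk`,
`w_k = (HHᵀ)_kk`, `s_k = (Z₂₁(CA)ᵀ)_kk` (`C·B = 0`), `q_k = (C·X·Cᵀ)_kk` with `X = Xlit` (`= Z₁₁Aᵀ + AZ₁₁`, file 1);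
(D2) `−a0b0·u + (a0+b0)·v − w ≥ 0`, (D3′) `a0·q ≤ 2s`, (D4) `a0 < b0`, `tr Z₁₁ > 0`; diagonal channels: all five functionals
vanish; window points: the exact end-point cosines of `δ*_k ± γ₀` (and the centre `0` on the wide sine channels) against
`a0 / b0`, from the record's exact `cd / sd`.  Nothing here is a statement about a grid.
[cite: BoydVandenberghe2004, §5.9.4 (5.97)–(5.98); Khalil2002, §7.1 Example 7.5]
-/

namespace Summit.Ventures.GridStability.Lyapunov.NE39LossySplitLinesLPDual

open Matrix Literature.Computation.Certificates
open Literature.MathematicalPhysics.PowerSystems.LyapunovFunctionFamily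
open Summit.Ventures.GridStability.Models
open Summit.Ventures.GridStability.Lyapunov.NE39LossySplitLines (e1 AQ CQ BLQ)

/-! ### The dual functionals over `ℚ` -/

/-- `u_k = (CZ₁₁Cᵀ)_kk`. -/
def UQ (k : (Fin 10 × Fin 10) ⊕ (Fin 10 × Fin 10)) : ℚ := (CQ * Z11Q * CQᵀ) k k
/-- `v_k = (Z₂₁Cᵀ)_kk`. -/
def VQ (k : (Fin 10 × Fin 10) ⊕ (Fin 10 × Fin 10)) : ℚ := (Z21Q * CQᵀ) k k
/-- `w_k = (Z₂₂)_kk = |H_k|²`. -/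
def WQ (k : (Fin 10 × Fin 10) ⊕ (Fin 10 × Fin 10)) : ℚ := Z22Q k k
/-- `s_k = (Z₂₁(CA)ᵀ)_kk` (`C·B = 0`, so this IS the Popov coefficient). -/
def SQ (k : (Fin 10 × Fin 10) ⊕ (Fin 10 × Fin 10)) : ℚ := (Z21Q * (CQ * AQ)ᵀ) k k
/-- `q_k = (C·X·Cᵀ)_kk` with the table `X = Z₁₁Aᵀ + AZ₁₁` (`C·B = 0`, so this IS the positivity functional). -/
def QQ (k : (Fin 10 × Fin 10) ⊕ (Fin 10 × Fin 10)) : ℚ := (CQ * Xlit.submatrix e1 e1 * CQᵀ) k k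

/-! ### The acceptance tests (kernel) -/

set_option maxHeartbeats 40000000 in
/-- **(D2)** `t_k(a0, b0) ≥ 0` on every channel. -/
theorem testsD2 : ∀ k : (Fin 10 × Fin 10) ⊕ (Fin 10 × Fin 10), 0 ≤ -(a0K k * b0K k) * UQ k + (a0K k + b0K k) * VQ k - WQ k := by
  decide +kernel

set_option maxHeartbeats 40000000 in
/-- **(D3′)** `a0_k·q_k ≤ 2 s_k` on every channel. -/
theorem testsD3 : ∀ k : (Fin 10 × Fin 10) ⊕ (Fin 10 × Fin 10), a0K k * QQ k ≤ 2 * SQ k := by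
  decide +kernel

set_option maxHeartbeats 40000000 in
/-- **(D4a)** `a0 < b0`, and on the diagonal channels the five dual functionals vanish. -/
theorem testsD4 : ∀ k : (Fin 10 × Fin 10) ⊕ (Fin 10 × Fin 10), a0K k < b0K k ∧
    ((pairOf k).1 = (pairOf k).2 → UQ k = 0 ∧ VQ k = 0 ∧ WQ k = 0 ∧ SQ k = 0 ∧ QQ k = 0) := by
  decide +kernel

/-- **The LP dual scalar tests**, all 200 channels. -/
theorem lpDual_tests (k : (Fin 10 × Fin 10) ⊕ (Fin 10 × Fin 10)) :
    0 ≤ -(a0K k * b0K k) * UQ k + (a0K k + b0K k) * VQ k - WQ k ∧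
    a0K k * QQ k ≤ 2 * SQ k ∧ a0K k < b0K k ∧
    ((pairOf k).1 = (pairOf k).2 → UQ k = 0 ∧ VQ k = 0 ∧ WQ k = 0 ∧ SQ k = 0 ∧ QQ k = 0) :=
  ⟨testsD2 k, testsD3 k, (testsD4 k).1, (testsD4 k).2⟩

/-- **(D4b)** `tr Z₁₁ > 0`. -/
theorem trace_test : 0 < Matrix.trace Z11Q := by
  decide +kernel

/-! ### The window-point tests over `ℚ` (channels `p ≠ q`) -/

set_option maxHeartbeats 4000000 in
/-- **Sine channels `(p, q)`, `p ≠ q`**: end-point cosines `cd·cg0Q ∓ sd·sg0Q`; one is `≤ a0`; EITHER one is `≥ b0` (narrow)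
OR `ξ = 0` lies in the window (`cg0Q ≤ cd`) with `b0 ≤ 1` (wide). -/
theorem window_tests_sin : ∀ p q : Fin 10, p ≠ q →
    (NE39.preLossless.cd p q * cg0Q - NE39.preLossless.sd p q * sg0Q ≤ a0K (Sum.inl (p, q)) ∨
      NE39.preLossless.cd p q * cg0Q + NE39.preLossless.sd p q * sg0Q ≤ a0K (Sum.inl (p, q))) ∧
    ((b0K (Sum.inl (p, q)) ≤ NE39.preLossless.cd p q * cg0Q - NE39.preLossless.sd p q * sg0Q ∨
      b0K (Sum.inl (p, q)) ≤ NE39.preLossless.cd p q * cg0Q + NE39.preLossless.sd p q * sg0Q) ∨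
      (cg0Q ≤ NE39.preLossless.cd p q ∧ b0K (Sum.inl (p, q)) ≤ 1)) := by
  decide +kernel

set_option maxHeartbeats 4000000 in
/-- **Cosine channels `(p, q)`, `p ≠ q`**: end-point cosines `−sd·cg0Q ∓ cd·sg0Q`; one is `≤ a0`, one is `≥ b0`. -/
theorem window_tests_cos : ∀ p q : Fin 10, p ≠ q →
    (-NE39.preLossless.sd p q * cg0Q - NE39.preLossless.cd p q * sg0Q ≤ a0K (Sum.inr (p, q)) ∨
      -NE39.preLossless.sd p q * cg0Q + NE39.preLossless.cd p q * sg0Q ≤ a0K (Sum.inr (p, q))) ∧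
    (b0K (Sum.inr (p, q)) ≤ -NE39.preLossless.sd p q * cg0Q - NE39.preLossless.cd p q * sg0Q ∨
      b0K (Sum.inr (p, q)) ≤ -NE39.preLossless.sd p q * cg0Q + NE39.preLossless.cd p q * sg0Q) := by
  decide +kernel

/-- `0 < u₀ < 1` (so `0 < γ₀ < π/2`). -/
theorem u0Q_pos_lt : 0 < u0Q ∧ u0Q < 1 := by norm_num [u0Q]

end Summit.Ventures.GridStability.Lyapunov.NE39LossySplitLinesLPDual
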